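import Mathlib
import Summits.MatrixMultiplication.MatrixMultiplication.Theorems.SoloInformedCwTwoOnePairClosure
import Summits.MatrixMultiplication.MatrixMultiplication.Theorems.SoloInformedCwTwoHallSix

/-!
# Door D7: Theorem A stated over `IsMixedDesign`

`onePair_mixed_closure` (Theorem A, file `SoloInformedCwTwoOnePairClosure`) proves `4 · 2^q ≤ σ + 1` for a one-pair
mixed system from five explicit "no short relation" hypotheses.  This file derives those five hypotheses from the
design condition `IsMixedDesign` of `SoloInformedCwTwoHallSix` (the Gordan/vertex form: weights `y` with
`⟪y, r⟫ ≥ 1` on every nonzero allowed relation `r` of value `0`), so that the two proved cases of MIXED CLOSURE —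
one pair (`onePair_mixedClosure_of_isMixedDesign`, here) and all-tight (`tight_mixedClosure`) — are stated over the
same predicate as `HallSixConjecture`.

The derivation: distinct subset sums, `∑B ≠ s + ∑A`, `∑B ≠ d + ∑A`, `s + ∑B ≠ d + ∑A` are balanced families of
length two (`r` and `-r` both allowed); the fifth hypothesis (`∑B = s+d+∑A₁` and `2s + ∑A₁ = d + ∑A₂` cannot both
hold) is the long triangle `(-1,-1 | B-A₁) + (2,-1 | A₁-A₂) + (-1,2 | A₂-B) = 0` of three allowed value-`0` relations.

Written by the solo-informed seat (gen 13); standard axioms only.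
-/

namespace Summit.MatrixMultiplication.MatrixMultiplication.Theorems

open Finset

/-- Indicator of a finset as an integer vector. -/
def chiZ {q : ℕ} (A : Finset (Fin q)) : Fin q → ℤ := fun i => if i ∈ A then 1 else 0

/-- The subset sum as an indicator-weighted sum over all indices (cast to `ℤ`). -/
theorem subsetSum_eq_chi {q : ℕ} (t : Fin q → ℕ) (A : Finset (Fin q)) :
    ((subsetSum t A : ℕ) : ℤ) = ∑ i, chiZ A i * (t i : ℤ) := by
  classical
  unfold subsetSum chiZ
  push_cast
  rw [← Finset.sum_filter_add_sum_filter_not Finset.univ (fun i => i ∈ A)]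
  have h1 : (∑ i ∈ Finset.univ.filter (fun i => i ∈ A), (if i ∈ A then (1:ℤ) else 0) * (t i : ℤ)) = ∑ i ∈ A, (t i : ℤ) := by
    have : Finset.univ.filter (fun i => i ∈ A) = A := by ext i; simp
    rw [this]; apply Finset.sum_congr rfl; intro i hi; simp [hi]
  have h2 : (∑ i ∈ Finset.univ.filter (fun i => ¬ i ∈ A), (if i ∈ A then (1:ℤ) else 0) * (t i : ℤ)) = 0 := by
    apply Finset.sum_eq_zero; intro i hi; simp only [Finset.mem_filter] at hi; simp [hi.2]
  rw [h1, h2]; simp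

/-- Indicator differences have entries in `[-1, 1]`. -/
theorem chiZ_sub_bound {q : ℕ} (A B : Finset (Fin q)) (i : Fin q) :
    -1 ≤ chiZ A i - chiZ B i ∧ chiZ A i - chiZ B i ≤ 1 := by
  unfold chiZ; split_ifs <;> simp

/-- Equal indicators means equal finsets. -/
theorem eq_of_chiZ_sub_eq_zero {q : ℕ} (A B : Finset (Fin q)) (h : (fun i => chiZ A i - chiZ B i) = 0) : A = B := by
  ext i
  have hi := congrFun h i
  simp only [chiZ, Pi.zero_apply] at hi
  constructor
  · intro hA; by_contra hB; simp [hA, hB] at hi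
  · intro hB; by_contra hA; simp [hA, hB] at hi

/-- **Theorem A over `IsMixedDesign`.**  A one-pair mixed design (`p = 1`, `s < d`) satisfies `4 · 2^q ≤ σ + 1`. -/
theorem onePair_mixedClosure_of_isMixedDesign {q : ℕ} (s d : Fin 1 → ℕ) (t : Fin q → ℕ) (hsd : s 0 < d 0)
    (hD : IsMixedDesign s d t) : 4 * 2 ^ q ≤ mixedSigma s d t + 1 := by
  classical
  obtain ⟨_, ys, yd, yt, hy⟩ := hD
  -- the design inequality specialised to one pair
  have hy1 : ∀ (a0 b0 : ℤ) (c : Fin q → ℤ), (-1 ≤ a0 ∧ -1 ≤ b0 ∧ a0 + b0 ≤ 1) → (∀ i, -1 ≤ c i ∧ c i ≤ 1) →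
      a0 * (s 0 : ℤ) + b0 * (d 0 : ℤ) + ∑ i, c i * (t i : ℤ) = 0 → (a0 ≠ 0 ∨ b0 ≠ 0 ∨ c ≠ 0) →
      1 ≤ a0 * ys 0 + b0 * yd 0 + ∑ i, c i * yt i := by
    intro a0 b0 c hab hc hv hnz
    have h := hy (fun _ => a0) (fun _ => b0) c ⟨fun _ => hab, hc⟩
      (by simpa [Fin.sum_univ_one] using hv)
      (by
        rcases hnz with h | h | h
        · left; intro hz; exact h (by simpa using congrFun hz 0)
        · right; left; intro hz; exact h (by simpa using congrFun hz 0)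
        · right; right; exact h)
    simpa [Fin.sum_univ_one] using h
  -- balanced families of length two
  have two : ∀ (a0 b0 : ℤ) (c : Fin q → ℤ), (-1 ≤ a0 ∧ a0 ≤ 1) → (-1 ≤ b0 ∧ b0 ≤ 1) → (-1 ≤ a0 + b0 ∧ a0 + b0 ≤ 1) →
      (∀ i, -1 ≤ c i ∧ c i ≤ 1) → a0 * (s 0 : ℤ) + b0 * (d 0 : ℤ) + ∑ i, c i * (t i : ℤ) = 0 →
      (a0 = 0 ∧ b0 = 0 ∧ c = 0) := by
    intro a0 b0 c ha hb hab hc hv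
    by_contra hne
    have hnz : a0 ≠ 0 ∨ b0 ≠ 0 ∨ c ≠ 0 := by
      by_contra h'
      push Not at h'
      exact hne ⟨h'.1, h'.2.1, h'.2.2⟩
    have i1 := hy1 a0 b0 c ⟨ha.1, hb.1, hab.2⟩ hc hv hnz
    have i2 := hy1 (-a0) (-b0) (fun i => -c i) ⟨by linarith [ha.2], by linarith [hb.2], by linarith [hab.1]⟩
      (fun i => ⟨by linarith [(hc i).2], by linarith [(hc i).1]⟩)
      (by
        have e : (∑ i, (-c i) * (t i : ℤ)) = -∑ i, c i * (t i : ℤ) := by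
          rw [← Finset.sum_neg_distrib]; apply Finset.sum_congr rfl; intro i _; ring
        rw [e]; linarith)
      (by
        rcases hnz with h | h | h
        · left; simpa using h
        · right; left; simpa using h
        · right; right; intro hz; apply h; funext i; have := congrFun hz i; simp at this; simpa using this)
    have e : (∑ i, (-c i) * yt i) = -∑ i, c i * yt i := by
      rw [← Finset.sum_neg_distrib]; apply Finset.sum_congr rfl; intro i _; ring
    rw [e] at i2
    linarith
  -- value bookkeeping: subset sums as indicator sums
  have vss : ∀ A B : Finset (Fin q),
      (∑ i, (chiZ A i - chiZ B i) * (t i : ℤ)) = (subsetSum t A : ℤ) - (subsetSum t B : ℤ) := by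
    intro A B
    rw [subsetSum_eq_chi, subsetSum_eq_chi, ← Finset.sum_sub_distrib]
    apply Finset.sum_congr rfl; intro i _; ring
  -- (1) distinct subset sums
  have hdiss : ∀ A B : Finset (Fin q), subsetSum t A = subsetSum t B → A = B := by
    intro A B h
    have hc := two 0 0 (fun i => chiZ A i - chiZ B i) (by norm_num) (by norm_num) (by norm_num)
      (fun i => chiZ_sub_bound A B i) (by rw [vss]; push_cast [h]; ring)
    exact eq_of_chiZ_sub_eq_zero A B hc.2.2
  -- (2) ∑B ≠ s + ∑A
  have hs : ∀ A B : Finset (Fin q), subsetSum t B ≠ s 0 + subsetSum t A := by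
    intro A B h
    have hc := two 1 0 (fun i => chiZ A i - chiZ B i) (by norm_num) (by norm_num) (by norm_num)
      (fun i => chiZ_sub_bound A B i)
      (by rw [vss]; have : ((subsetSum t B : ℕ) : ℤ) = (s 0 : ℤ) + (subsetSum t A : ℤ) := by exact_mod_cast h
          linarith)
    exact absurd hc.1 one_ne_zero
  -- (3) ∑B ≠ d + ∑A
  have hd : ∀ A B : Finset (Fin q), subsetSum t B ≠ d 0 + subsetSum t A := by
    intro A B h
    have hc := two 0 1 (fun i => chiZ A i - chiZ B i) (by norm_num) (by norm_num) (by norm_num)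
      (fun i => chiZ_sub_bound A B i)
      (by rw [vss]; have : ((subsetSum t B : ℕ) : ℤ) = (d 0 : ℤ) + (subsetSum t A : ℤ) := by exact_mod_cast h
          linarith)
    exact absurd hc.2.1 one_ne_zero
  -- (4) s + ∑B ≠ d + ∑A
  have hds : ∀ A B : Finset (Fin q), s 0 + subsetSum t B ≠ d 0 + subsetSum t A := by
    intro A B h
    have hc := two 1 (-1) (fun i => chiZ B i - chiZ A i) (by norm_num) (by norm_num) (by norm_num)
      (fun i => chiZ_sub_bound B A i)
      (by rw [vss]; have : (s 0 : ℤ) + (subsetSum t B : ℤ) = (d 0 : ℤ) + (subsetSum t A : ℤ) := by exact_mod_cast h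
          linarith)
    exact absurd hc.1 one_ne_zero
  -- (5) the long triangle
  have hconst : ∀ A₁ A₂ B : Finset (Fin q),
      subsetSum t B = s 0 + d 0 + subsetSum t A₁ → 2 * s 0 + subsetSum t A₁ ≠ d 0 + subsetSum t A₂ := by
    intro A₁ A₂ B h1 h2
    have h1' : ((subsetSum t B : ℕ) : ℤ) = (s 0 : ℤ) + (d 0 : ℤ) + (subsetSum t A₁ : ℤ) := by exact_mod_cast h1
    have h2' : 2 * (s 0 : ℤ) + (subsetSum t A₁ : ℤ) = (d 0 : ℤ) + (subsetSum t A₂ : ℤ) := by exact_mod_cast h2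
    let c1 : Fin q → ℤ := fun i => chiZ B i - chiZ A₁ i
    let c2 : Fin q → ℤ := fun i => chiZ A₁ i - chiZ A₂ i
    let c3 : Fin q → ℤ := fun i => chiZ A₂ i - chiZ B i
    have i1 := hy1 (-1) (-1) c1 (by norm_num) (fun i => chiZ_sub_bound B A₁ i)
      (by simp only [c1]; rw [vss]; linarith) (by left; norm_num)
    have i2 := hy1 2 (-1) c2 (by norm_num) (fun i => chiZ_sub_bound A₁ A₂ i)
      (by simp only [c2]; rw [vss]; linarith) (by left; norm_num)
    have i3 := hy1 (-1) 2 c3 (by norm_num) (fun i => chiZ_sub_bound A₂ B i)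
      (by simp only [c3]; rw [vss]; linarith) (by left; norm_num)
    have hsum : (∑ i, c1 i * yt i) + (∑ i, c2 i * yt i) + (∑ i, c3 i * yt i) = 0 := by
      rw [← Finset.sum_add_distrib, ← Finset.sum_add_distrib]
      apply Finset.sum_eq_zero; intro i _; simp only [c1, c2, c3]; ring
    linarith
  have hA := onePair_mixed_closure t (s 0) (d 0) hsd hdiss hs hd hds hconst
  simpa [mixedSigma, Fin.sum_univ_one, Nat.add_assoc] using hA

end Summit.MatrixMultiplication.MatrixMultiplication.Theorems
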